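import Summits.ValiantsHypothesis.ValiantsHypothesis.Theorems.KPlusLogSqLawTropicalBToeplitzSuperlinear

/-!
# Route `KPlusLogSqLaw`, crux `TropicalB` — Toeplitz sector: the super-linear floor at EVERY size, and the REPAIRED linear conjectures are false

HONEST FRAMING.  Helper toward the registered stubs `stub_tropThin` / `stub_tropFat` (crux `…Theses.KPlusLogSqLaw.TropicalB`, item
`stmt-ValiantsHypothesis-19771`; cell `pub-symmetroid`, seat `val-sym-trop-p4` (g23), 2026-08-29).  (1) The tower
`Φ_Q(32·2^k) ≥ 2^k(160+4k) + 1` (`…ToeplitzSuperlinear`) transported to every size by the monotonicity of `Φ_Toep` in the size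
(`LinearInstanceBound.of_le`, corner pin): for `32·2^k ≤ m`, `LinearInstanceBound m Φ → 2^k(160+4k) + 1 ≤ Φ`; with `k = ⌊log₂(m/32)⌋` this is
an explicit `Ω(m log m)` floor at every `m ≥ 32`.  (2) PRECISION OF RECORD (critic val-idea-crit-6 g8, READ #263, P-m0): the cell's NAMED linear
conjectures `ConjectureQ` / `ConjectureTLinear` are junk-false already at `m = 0` (`C·0 = 0 < 1 = Φ_Toep(0)`), so `¬ConjectureQ` as a TYPE carries no
content; the content is the explicit-size failure.  Here the REPAIRED forms (sizes `m ≥ 1`, i.e. what the cell meant) are refuted with the same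
witness size `32·2^(8C)`: `not_fixedSlopeInstanceBound_sq_linear_succ` (even the bound `C·(m+1)` fails there), `not_conjectureQ_pos`,
`not_conjectureTLinear_pos` (stated inline, no new `Prop` is defined).  `ConjectureTPoly` (correctly typed, `(0+1)^C = 1`) is untouched; nothing
here bears on `TropicalB` for general designs, `MatrixDescartes` or `VP ≠ VNP`.
-/

set_option linter.dupNamespace false
set_option autoImplicit false

namespace Summit.ValiantsHypothesis.ValiantsHypothesis.Theorems.KPlusLogSqLaw.Toeplitz

/-- **Super-linear floor at every size**: if `32·2^k ≤ m` then `Φ_Toep(m) ≥ 2^k(160 + 4k) + 1`. -/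
theorem le_of_linearInstanceBound_superlinear {m Φ : ℕ} (k : ℕ) (hk : 32 * 2 ^ k ≤ m) (h : LinearInstanceBound m Φ) :
    2 ^ k * (160 + 4 * k) + 1 ≤ Φ :=
  le_of_linearInstanceBound_tower32_superlinear k (h.of_le hk)

/-- the same with `k = log₂ (m / 32)`: for `m ≥ 32`, `Φ_Toep(m) ≥ 2^{⌊log₂(m/32)⌋}·(160 + 4⌊log₂(m/32)⌋) + 1` (and `2^{⌊log₂(m/32)⌋} > m/64`). -/
theorem le_of_linearInstanceBound_log {m Φ : ℕ} (hm : 32 ≤ m) (h : LinearInstanceBound m Φ) :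
    2 ^ Nat.log 2 (m / 32) * (160 + 4 * Nat.log 2 (m / 32)) + 1 ≤ Φ := by
  refine le_of_linearInstanceBound_superlinear (Nat.log 2 (m / 32)) ?_ h
  have h1 : 2 ^ Nat.log 2 (m / 32) ≤ m / 32 := Nat.pow_log_le_self 2 (by omega)
  omega

/-- **Even the bound `C·(m+1)` fails** at `m = 32·2^(8C)`, for every `C`. -/
theorem not_fixedSlopeInstanceBound_sq_linear_succ (C : ℕ) :
    ¬ FixedSlopeInstanceBound (32 * 2 ^ (8 * C)) (fun δ : ℤ => δ ^ 2) (C * (32 * 2 ^ (8 * C) + 1)) := by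
  intro h
  have hC : C ≤ 160 * 2 ^ (8 * C) := by
    have h1 : C < 2 ^ C := Nat.lt_two_pow_self
    have h2 : 2 ^ C ≤ 2 ^ (8 * C) := Nat.pow_le_pow_right (by norm_num) (by omega)
    omega
  have hle : C * (32 * 2 ^ (8 * C) + 1) ≤ 2 ^ (8 * C) * (160 + 4 * (8 * C)) := by
    have e : C * (32 * 2 ^ (8 * C) + 1) = 2 ^ (8 * C) * (32 * C) + C := by ring
    have e' : 2 ^ (8 * C) * (160 + 4 * (8 * C)) = 2 ^ (8 * C) * (32 * C) + 160 * 2 ^ (8 * C) := by ring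
    rw [e, e']
    omega
  exact not_fixedSlopeInstanceBound_sq_tower32_superlinear (8 * C) (h.mono hle)

/-- **The REPAIRED Conjecture Q (sizes `m ≥ 1`) is false**: there is no `C` with `Φ_Q(m) ≤ C·m` for all `m ≥ 1`. -/
theorem not_conjectureQ_pos :
    ¬ (∃ C : ℕ, ∀ m : ℕ, 1 ≤ m → FixedSlopeInstanceBound m (fun δ : ℤ => δ ^ 2) (C * m)) := by
  rintro ⟨C, hC⟩
  have hm : 1 ≤ 32 * 2 ^ (8 * C) := by have := Nat.one_le_two_pow (n := 8 * C); omega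
  exact not_fixedSlopeInstanceBound_sq_linear C (hC _ hm)

/-- **The REPAIRED linear Conjecture T (sizes `m ≥ 1`) is false**: there is no `C` with `Φ_Toep(m) ≤ C·m` for all `m ≥ 1`. -/
theorem not_conjectureTLinear_pos : ¬ (∃ C : ℕ, ∀ m : ℕ, 1 ≤ m → LinearInstanceBound m (C * m)) := by
  rintro ⟨C, hC⟩
  have hm : 1 ≤ 32 * 2 ^ (8 * C) := by have := Nat.one_le_two_pow (n := 8 * C); omega
  exact not_fixedSlopeInstanceBound_sq_linear C (fixedSlope_of_linear (hC _ hm) _)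

end Summit.ValiantsHypothesis.ValiantsHypothesis.Theorems.KPlusLogSqLaw.Toeplitz
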